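import Summits.QuantumFields.YangMills.Theorems.BalabanUVNodesN11NoExpansionGeneralStepCoPH
import Summits.QuantumFields.YangMills.Theorems.BalabanUVNodesN11NoExpansionTruncatedWitness
import Literature.MathematicalPhysics.QuantumFieldTheory.Balaban1983to89.B16RLeafRecord13LiveGenericZS

/-!
# DAG node N11 — THE NO-EXPANSION STEP AFTER AN ARBITRARY HISTORY AT THE v1.7 `CoPH` RECORD, LAW LEVEL: at a new sequence `s′` with `Ω_{k+1}(s′) = ∅` the §2 form of
# `ρ_k` (`SLaw₁₃CoPH θ p k`: laws `LawsRT … k` AND clause at `init s′`) gives THE WHOLE PER-SEQUENCE CONJUNCT of the 𝐓-image form at `s′` — the law package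
# `Sect2.LawsT … k` AND the clause — for the carried witness TRUNCATED ABOVE LEVEL `k` (print (3.25): «no new terms» at a no-expansion step), and, through 𝐑 on the
# live-selector line, the per-sequence conjunct `Sect2.LawsRT … (k+1)` ∧ clause of the §2 form OF `ρ_{k+1}` at `s′`

Cell `pub-ymgap`, YM-PLAN Track A (HUMAN RULING D-0062), seat `pub-ymgap-dag-n11-e` (g12; R134 fan-out row N11∕s3 «`ThmP245Printed` via `rOperation` from N13's
`ROpLeaf` (pairs with n13-c)»), route `BalabanUVNodes` rev 25 (v1.7 `CoPH` key), item K1⁷ `StabilityBAtRecordR13SepCoPH` = stmt-QuantumFields-20542 (helper lane,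
count-neutral).  [III] = [Balaban1988Convergent], [IV] = [Balaban1989LargeFieldI].  The law-level companion of this seat's clause-level
`…BalabanUVNodesN11NoExpansionGeneralStepPostRCoPH` (same two imports: dag-n11-d's `…NoExpansionGeneralStepCoPH` p544575 and this seat's `…B16RLeafRecord13LiveGenericZS` p539943).

WHY THIS FILE.  node00-def-T's §2-form predicates `HasSect2FormAEZS ∕ TAEZS` (FILE 27 §0a) demand, PER SEQUENCE, a LAW PACKAGE on the tower of record of the witness's term
values — `Sect2.LawsRT … k` ((2.27)–(2.31), (2.41)–(2.42) for `j ≤ k`, analyticity) for `ρ_k`, `Sect2.LawsT … k` (old terms as at `k`, r11's new-term obligations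
`LFNewTerms … k` at the index `k+1`, analyticity through `k+1`) for the 𝐓-image — AND the identity clause.  dag-n11-d's any-history no-expansion step (p544575) and this
seat's 𝐑-transfer (p539943 §0) are CLAUSE-level: they carry the witness `t (init s′)` of `SLaw₁₃CoPH θ p k` to `s′` unchanged.  That witness's level-`(k+1)` values are
unconstrained by `LawsRT … k`, so it need not satisfy `LawsT … k`; but at a no-expansion step the slot at `s′` DOES NOT READ the witness above level `k` (dag-n11-d's
`action23_succ_eq_init_of_Omega_empty`, p531413: the scale-`(k+1)` ranges of (2.25), (2.30), (2.40) are empty at `Λ_{k+1}(s′) = Ω_{k+1}(s′) = ∅`), so the witness may be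
TRUNCATED above level `k` — print's «A_{k+1} restricted … is simply A_k» ((3.25) p. 270): NO new terms `𝐄^{(k+1)}, 𝐑^{(k+1)}, 𝐁^{(k+1)}` along such an `s′` — and the
truncated witness satisfies `LawsT … k` from `LawsRT … k` alone: old levels verbatim (the tower at `s′` with the history's residual `θ.rzAt p s′` IS the tower at `init s′` —
same `Ω`-function, and the tower reads only `bgI ∕ bgMS` of the residual), the new-term obligations at `k+1` by the ZERO values under the signs `0 ≤ E₀, B₀`, `0 ≤ g_{k+1}`
(free along every ₁₃ history) and the RG equation of the run's flow (a theorem of record).  HENCE: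
§0∕§1 = the companion file `…BalabanUVNodesN11NoExpansionTruncatedWitness` (split off by the 400-line rule): `lawsT_towerOfTerms_of_lawsRT_of_agree_of_vanish` (term values agreeing with `t` at the levels `≤ k` and VANISHING at level `k+1` obey `LawsT … k` on
   the same frame as soon as `t` obeys `LawsRT … k`, given the RG equation at `k` and the three signs) · `action23_actionDataOfTerms_congr_of_agree` ((2.23) at index `k` reads
   the term values at the levels `1 … k` only).
§1 (of record, generic setting ∕ residual ∕ weights) `sect2Operand_succ_congr_of_agree_of_Omega_empty` ∕ `sect2Slot_succ_congr_of_agree_of_Omega_empty`: at a no-expansion `s′`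
   the operand `e^{A_{k+1}(s′)}` and the slot `𝐓_{k+1}(s′) e^{A_{k+1}(s′)}` do not read the witness above level `k` (`M ≥ 1`).
§2 (the v1.7 record, generic `θ : Stage13HParams`) `sect2TowerOfRecord_rzAt_succ_eq_init_of_Omega_empty` (the history's tower at `s′` IS the one at `init s′`) · ★
   `exists_lawsT_clause_succ_CoPH_of_Omega_empty_of_lawsRT_of_clause` (CLAUSE-KEYED core: a witness `(t, E₀)` with `LawsRT … k` AND the clause at `init s′` ⇒ `∃ t₀`, `LawsT … k`
   AND the 𝐓-image clause at `s′`, same constant) · ★ `exists_lawsRT_slotClause_succ_CoPH_of_Omega_empty_of_lawsRT_of_clause_of_liveSel` (its reading through 𝐑) · ★★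
   `exists_lawsT_clause_succ_CoPH_of_Omega_empty_of_sLaw₁₃CoPH` — THE 𝐓-SIDE, LAW + CLAUSE: from `SLaw₁₃CoPH θ p k`, the core provisos, `k < K`, `1 ≤ M`, `0 ≤ E₀, B₀` and
   dag-n11-d's displayed (P)∕(V)∕locality∕measurability data at `s′` VERBATIM (p544575 `exists_clause_succ_CoPH_of_Omega_empty_of_sLaw₁₃CoPH`), THERE ARE term values `t₀` and
   a constant `E′` with `Sect2.LawsT (sect2TowerOfRecord … (θ.rzAt p s′) s′ t₀) lf βc k` AND the 𝐓-image clause of `slotT_{k+1}(s′)` at `(t₀, E′)` — i.e. the complete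
   `s′`-conjunct of `TLaw₁₃CoPH θ p k`'s predicate `HasSect2FormTAEZS` (witness: `t (init s′)` truncated above `k`, `E′ = E_k(init s′)`) · ★★
   `exists_lawsRT_slotClause_succ_CoPH_of_Omega_empty_of_sLaw₁₃CoPH_of_liveSel` — THROUGH 𝐑 ON THE LIVE-SELECTOR LINE: under admissibility and `0 ≤ κ` in addition, the complete
   `s′`-conjunct of `SLaw₁₃CoPH θ p (k+1)`'s predicate `HasSect2FormAEZS`: `Sect2.LawsRT … (k+1)` (11c's `LawsT.toRT_succ`) ∧ the post-𝐑 §2 dichotomy of `ρ_{k+1}`'s slot at `s′`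
   (this seat's `slotClauseΦ_succ_of_slotTClauseΦ_of_liveSel_of_rstep`).

HONEST FRAMING.  Count-neutral kernel bookkeeping at ONE new sequence per old history on the no-expansion branch; what it adds to the clause-level files is exactly the
law package of the (truncated) carried witness, obtained from `SLaw_k`'s law package by bookkeeping — NO estimate of [III] §3 is used or asserted (the improved bounds of
`LFNewTerms` hold for ZERO new terms).  NOT `TLaw₁₃CoPH θ p k`, NOT `SLaw₁₃CoPH θ p (k+1)` (both quantify over ALL new sequences, incl. `Ω_{k+1}(s′) ≠ ∅` = [III] Sect. 1 ∕ §3 ∕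
Thm 2 proper, and require a witness family universal in its 𝐄-component — print's universal `𝐄^{(k+1)}` comes from the expansion branch; the truncated witness is the right
one sequence by sequence only); the (P)∕(V)∕locality∕`hm`∕`hC` binders stay DISPLAYED as in p544575; the zero branch is not excluded; nothing of Bałaban asserted; N11 NOT
discharged; K1⁷ NOT closed; counts unmoved (typed 28∕28 · discharged 5∕27).  One finite `𝕋⁴_{L^K}` programme at fixed `ε = L^{−K}`; NOT ℝ⁴ ∕ OS ∕ mass-gap ∕ Clay.
Sources: [III] Thm 1 p.262, §2 p.262 («the newly created expressions…»), Theorem p.245, (2.23)–(2.31) pp.258–260, (2.40)–(2.42) p.261, (3.24)–(3.25) p.270, p.279;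
[IV] (0.2)–(0.4) p.176, p.177 (i)–(ii); [Balaban1987RG1] (0.20) p.256.
-/

noncomputable section

open MeasureTheory
open scoped BigOperators Matrix.Norms.L2Operator

namespace Summit.QuantumFields.YangMills.Theorems.BalabanUVNodesN11NoExpansionGeneralStepLawsCoPH

open Literature.MathematicalPhysics.QuantumFieldTheory.Balaban1983to89 T4Continuum Node00 Node00.Tk DagBinding
open Literature.MathematicalPhysics.QuantumFieldTheory.Balaban1983to89.B16RLeafRecord13LiveGenericZS
open BalabanUVNodesN11NoExpansionActionSucc (seq_init_Ω_eq_of_Omega_empty)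
open BalabanUVNodesN11NoExpansionTruncatedWitness (lawsT_towerOfTerms_of_lawsRT_of_agree_of_vanish sect2Slot_succ_congr_of_agree_of_Omega_empty)
open BalabanUVNodesN11NoExpansionGeneralStepCoPH (clause_succ_CoPH_of_Omega_empty_of_pinChi_of_provisos_of_clause)

/-! ## §2. The v1.7 `CoPH` record, generic `θ : Stage13HParams` — the 𝐓-side law + clause at `s′` from `SLaw_k`, and its reading through 𝐑 on the live-selector line -/

section LawsCoPH

variable {F : T4Family} {N : ℕ} [NeZero N]
variable (θ : Stage13HParams F N) (p : B12.RunParams)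

/-- **THE HISTORY's §2 TOWER AT A NO-EXPANSION `s′` IS THE ONE AT `init s′`** for every term-value witness: `init s′` and `s′` have the same `Ω`-function (dag-n11-d's
`seq_init_Ω_eq_of_Omega_empty`), and 11b's tower reads the residual only through `bgI ∕ bgMS`, which the history's residuals `θ.rzAt p s′`, `θ.rzAt p (init s′)` share (`rfl`;
the smearing functions `φ_j` enter (2.23), not the spaces). [cite: Balaban1988Convergent, p.257, (2.27)(ii) p.259, (2.34)–(2.39) p.261] -/
theorem sect2TowerOfRecord_rzAt_succ_eq_init_of_Omega_empty {k : ℕ}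
    (s : SeqOfRecord F θ.ν θ.τ9.M (gOfRecord₁₃ F N θ.toStage13Params p) p.K (k + 1)) (hΩ : s.Ω (k + 1) = ∅)
    (u : Sect2.TermValues (F.P p.K) (MatA N) (FluctV N) θ.τ9.M) :
    sect2TowerOfRecord F N (FluctV N) p.K (settingOfRecord₁₃ F N θ.toStage13Params p) (θ.rzAt p s) s u =
      Sect2.towerOfTerms (settingOfRecord₁₃ F N θ.toStage13Params p) (θ.rzAt p s.init) θ.τ9.M s.init.Ω u := by
  rw [sect2TowerOfRecord_eq, ← seq_init_Ω_eq_of_Omega_empty s hΩ]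
  rfl

/-- **★ THE 𝐓-SIDE OF THE NO-EXPANSION STEP AFTER ANY HISTORY, LAW + CLAUSE, CLAUSE-KEYED** (generic `θ : Stage13HParams`, v1.7 core provisos, `k < K`, `1 ≤ M`,
`0 ≤ E₀, B₀`): a witness `(t, E₀)` carrying at `init s′` BOTH the inductive assumptions `Sect2.LawsRT (sect2TowerOfRecord … (θ.rzAt p (init s′)) (init s′) t) lf k` AND the
level-`k` clause `hid`, at a new sequence `s′` with `Ω_{k+1}(s′) = ∅` (ANY history), under dag-n11-d's displayed data for that witness VERBATIM (`hqloc`, (P) `hpre`, `hA`, (V)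
`hZ` + `hq`, `hm` ∕ `hC` — p544575 `clause_succ_CoPH_of_Omega_empty_of_pinChi_of_provisos_of_clause`), yields term values `t₀` with (i) the 𝐓-image LAW PACKAGE
`Sect2.LawsT (sect2TowerOfRecord … (θ.rzAt p s′) s′ t₀) lf βc k` AND (ii) the 𝐓-image clause of `slotT_{k+1}(s′)` at `(t₀, E₀)` (same constant).  Witness: `t` TRUNCATED
above level `k`; (i) by §0 through `sect2TowerOfRecord_rzAt_succ_eq_init_of_Omega_empty`, the run's RG equation (`settingOfRecord₁₃_satisfiesRG`) and `0 ≤ g_{k+1}`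
(`gOfRecord₁₃_succ_nonneg`); (ii) is dag-n11-d's clause for `t` read through §1. [cite: Balaban1988Convergent, Thm 1 p.262, §2 p.262, Theorem p.245, (3.24)–(3.25) p.270, (2.23)–(2.31) pp.258–260, (2.40)–(2.42) p.261; Balaban1989LargeFieldI, (0.2)–(0.3) p.176; Balaban1987RG1, (0.20) p.256] -/
theorem exists_lawsT_clause_succ_CoPH_of_Omega_empty_of_lawsRT_of_clause (h : θ.Provisos₁₃CoPH F N) {k : ℕ} (hk : k < p.K) (hM : 1 ≤ θ.τ9.M)
    (hE₀ : 0 ≤ θ.s2.lf.E₀) (hB₀ : 0 ≤ θ.s2.lf.B₀)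
    (s : SeqOfRecord F θ.ν θ.τ9.M (gOfRecord₁₃ F N θ.toStage13Params p) p.K (k + 1)) (hΩ : s.Ω (k + 1) = ∅)
    (hqloc : ∀ j, j < k → ∀ ω ω' : MultiCfg (F.P p.K) (SU N) (FluctV N), (∀ i, i ≤ k → ω i = ω' i) →
      (θ.zhAt p s).quad j (s.init.Λ (j + 1)) ω = (θ.zhAt p s).quad j (s.init.Λ (j + 1)) ω')
    (hpre : ∀ j, j < k → (θ.zhAt p s).ζ0 j = (θ.zhAt p s.init).ζ0 j ∧ (θ.zhAt p s).quad j = (θ.zhAt p s.init).quad j)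
    (t : Sect2.TermValues (F.P p.K) (MatA N) (FluctV N) θ.τ9.M) (E₀ : ℝ)
    (hA : ∀ (S : ℕ → Set (Site (F.P p.K) 0)) (a a' : Tk.MSFluct (F.P p.K) (FluctV N)) (Uf : GaugeField (F.P p.K) 0 (SU N)), (∀ i, i ≤ k → a i = a' i) →
      (sect2ActionDataOfRecord F N (FluctV N) p.K (settingOfRecord₁₃ F N θ.toStage13Params p) (θ.rzAt p s.init) s.init t (S, a) E₀).action23 k Uf =
        (sect2ActionDataOfRecord F N (FluctV N) p.K (settingOfRecord₁₃ F N θ.toStage13Params p) (θ.rzAt p s.init) s.init t (S, a') E₀).action23 k Uf)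
    (hlaw : Sect2.LawsRT (sect2TowerOfRecord F N (FluctV N) p.K (settingOfRecord₁₃ F N θ.toStage13Params p) (θ.rzAt p s.init) s.init t)
      (settingOfRecord₁₃ F N θ.toStage13Params p).lf k)
    (hid : slotsOfRecord F N θ.ν θ.τ9 (EOfRecord₁₃ F N θ.toStage13Params) (wOfRecord₉ F N θ.toStage9Params) θ.ppSel p
        (gOfRecord₁₃ F N θ.toStage13Params p) k s.init = 0 ∨
      ∀ᵐ U₀ ∂fieldMeasure (F.P p.K) k (SU N),
        chiSeqOfRecord F N θ.ν θ.τ9.M (gOfRecord₁₃ F N θ.toStage13Params p) p.K k s.init U₀ ≠ 0 →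
          slotsOfRecord F N θ.ν θ.τ9 (EOfRecord₁₃ F N θ.toStage13Params) (wOfRecord₉ F N θ.toStage9Params) θ.ppSel p
              (gOfRecord₁₃ F N θ.toStage13Params p) k s.init U₀ =
            sect2Slot F N (FluctV N) p.K (settingOfRecord₁₃ F N θ.toStage13Params p) (θ.rzAt p s.init) (WtOfRecord₁₃H F N θ p s.init) s.init t E₀
              (UbgOfRecord₁₃CoP F N θ.toStage13Params p k s.init) U₀)
    (hZ : ∀ (V' : GaugeField (F.P p.K) (k + 1) (SU N)) (U₀ : GaugeField (F.P p.K) k (SU N)),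
      (θ.zhAt p s).ζ0 k Set.univ (pairCfgAt (V := FluctV N) k V' U₀) =
        chiSeqOfRecord F N θ.ν θ.τ9.M (gOfRecord₁₃ F N θ.toStage13Params p) p.K k s.init U₀ *
          wOfRecord₉ F N θ.toStage9Params p (gOfRecord₁₃ F N θ.toStage13Params p) k s U₀ ((avOfRecord F N p.K k).avg U₀))
    (hq : ∀ (V' : GaugeField (F.P p.K) (k + 1) (SU N)) (U₀ : GaugeField (F.P p.K) k (SU N)), (θ.zhAt p s).quad k ∅ (pairCfgAt (V := FluctV N) k V' U₀) = 0)
    {C : ℝ}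
    (hm : ∀ S ∈ admSOfRecord F θ.ν θ.τ9.M (gOfRecord₁₃ F N θ.toStage13Params p) p.K k s.init,
      Measurable (Function.uncurry (noExpIntegrandAt F N (FluctV N) p.K k (WtOfRecord₁₃H F N θ p s)
        (tkBranchOfRecord F N (FluctV N) θ.ν θ.τ9.M _ p.K (WtOfRecord₁₃H F N θ p s) s.init S k
          (fun ω => sect2Operand F N (FluctV N) p.K (settingOfRecord₁₃ F N θ.toStage13Params p) (θ.rzAt p s) s t E₀
            (UbgOfRecord₁₃CoP F N θ.toStage13Params p (k + 1) s) (S, fun j => (ω j).2) (fun j => (ω j).1))))))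
    (hC : ∀ S ∈ admSOfRecord F θ.ν θ.τ9.M (gOfRecord₁₃ F N θ.toStage13Params p) p.K k s.init, ∀ V' U₀,
      |noExpIntegrandAt F N (FluctV N) p.K k (WtOfRecord₁₃H F N θ p s)
        (tkBranchOfRecord F N (FluctV N) θ.ν θ.τ9.M _ p.K (WtOfRecord₁₃H F N θ p s) s.init S k
          (fun ω => sect2Operand F N (FluctV N) p.K (settingOfRecord₁₃ F N θ.toStage13Params p) (θ.rzAt p s) s t E₀
            (UbgOfRecord₁₃CoP F N θ.toStage13Params p (k + 1) s) (S, fun j => (ω j).2) (fun j => (ω j).1)))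
        V' U₀| ≤ C) :
    ∃ t₀ : Sect2.TermValues (F.P p.K) (MatA N) (FluctV N) θ.τ9.M,
      Sect2.LawsT (sect2TowerOfRecord F N (FluctV N) p.K (settingOfRecord₁₃ F N θ.toStage13Params p) (θ.rzAt p s) s t₀)
          (settingOfRecord₁₃ F N θ.toStage13Params p).lf (settingOfRecord₁₃ F N θ.toStage13Params p).βc k ∧
        (slotsTOfRecord F N θ.ν θ.τ9 (EOfRecord₁₃ F N θ.toStage13Params) (wOfRecord₉ F N θ.toStage9Params) θ.ppSel p
            (gOfRecord₁₃ F N θ.toStage13Params p) (k + 1) s = 0 ∨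
          ∀ᵐ V' ∂fieldMeasure (F.P p.K) (k + 1) (SU N),
            chiSeqOfRecord F N θ.ν θ.τ9.M (gOfRecord₁₃ F N θ.toStage13Params p) p.K (k + 1) s V' ≠ 0 →
              slotsTOfRecord F N θ.ν θ.τ9 (EOfRecord₁₃ F N θ.toStage13Params) (wOfRecord₉ F N θ.toStage9Params) θ.ppSel p
                  (gOfRecord₁₃ F N θ.toStage13Params p) (k + 1) s V' =
                sect2Slot F N (FluctV N) p.K (settingOfRecord₁₃ F N θ.toStage13Params p) (θ.rzAt p s) (WtOfRecord₁₃H F N θ p s) s t₀ E₀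
                  (UbgOfRecord₁₃CoP F N θ.toStage13Params p (k + 1) s) V') := by
  -- the carried witness `t` TRUNCATED above level `k` (print: no new terms at a no-expansion step)
  let t' : Sect2.TermValues (F.P p.K) (MatA N) (FluctV N) θ.τ9.M :=
    ⟨fun j X z gc φ => if j ≤ k then t.E j X z gc φ else 0, fun j X φ => if j ≤ k then t.R j X φ else 0,
      fun j X φ a => if j ≤ k then t.B j X φ a else 0⟩
  have hE : ∀ j, j ≤ k → ∀ X z gc φ, t'.E j X z gc φ = t.E j X z gc φ := fun j hj X z gc φ => if_pos hj
  have hR : ∀ j, j ≤ k → ∀ X φ, t'.R j X φ = t.R j X φ := fun j hj X φ => if_pos hj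
  have hB : ∀ j, j ≤ k → ∀ X φ a, t'.B j X φ a = t.B j X φ a := fun j hj X φ a => if_pos hj
  have hE' : ∀ X z gc φ, t'.E (k + 1) X z gc φ = 0 := fun X z gc φ => if_neg (Nat.not_succ_le_self k)
  have hR' : ∀ X φ, t'.R (k + 1) X φ = 0 := fun X φ => if_neg (Nat.not_succ_le_self k)
  have hB' : ∀ X φ a, t'.B (k + 1) X φ a = 0 := fun X φ a => if_neg (Nat.not_succ_le_self k)
  refine ⟨t', ?_, ?_⟩
  · -- (i) the law package of the 𝐓-image at `s′` for the truncated witness: old levels from the laws at `init s′`, level `k+1` absent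
    rw [sect2TowerOfRecord_rzAt_succ_eq_init_of_Omega_empty θ p s hΩ]
    exact lawsT_towerOfTerms_of_lawsRT_of_agree_of_vanish _ _ _ hE hR hB hE' hR' hB' hlaw
      (settingOfRecord₁₃_satisfiesRG F N θ.toStage13Params p (k + 1) k (Nat.lt_succ_self k)) hE₀ hB₀
      (B16RLeafRecord13Live.gOfRecord₁₃_succ_nonneg F N θ.toStage13Params p k)
  · -- (ii) the clause: dag-n11-d's 𝐓-step for `t`; the slot at `s′` does not read the witness above level `k`
    rw [sect2Slot_succ_congr_of_agree_of_Omega_empty (FluctV N) _ _ _ hM s hΩ hE hR hB]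
    exact clause_succ_CoPH_of_Omega_empty_of_pinChi_of_provisos_of_clause θ p h hk hM s hΩ hqloc hpre t E₀ hA hid hZ hq hm hC

/-- **★★ THE 𝐓-SIDE OF THE NO-EXPANSION STEP AFTER ANY HISTORY, LAW + CLAUSE, from `SLaw₁₃CoPH θ p k`.**  For `θ : Stage13HParams` with the v1.7 core provisos, `k < K`, `1 ≤ M`,
`0 ≤ E₀, B₀`, the §2 form of `ρ_k`, a new sequence `s′` with `Ω_{k+1}(s′) = ∅` after ANY history, and dag-n11-d's displayed data at `s′` VERBATIM (`hqloc`, (P) `hpre`, `hA`, (V)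
`hZ` + `hq`, `hm` ∕ `hC` for every `(t₀, E₀)` — p544575 `exists_clause_succ_CoPH_of_Omega_empty_of_sLaw₁₃CoPH`): THERE ARE term values `t₀` and a constant `E′` such that
(i) `Sect2.LawsT (sect2TowerOfRecord … (θ.rzAt p s′) s′ t₀) lf βc k` — the LAW PACKAGE of the 𝐓-image at `s′` — AND (ii) the 𝐓-image clause «`slotT_{k+1}(s′) = 0 ∨ slotT_{k+1}(s′)
= 𝐓_{k+1}(s′) e^{A_{k+1}(s′)}` at `(t₀, E′)` a.e. on `supp χ_{k+1}(s′)`»; i.e. the complete `s′`-conjunct of node00-def-T's `HasSect2FormTAEZS`.  Witness: `SLaw_k`'s `t (init s′)`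
TRUNCATED above level `k` (zero `𝐄^{(j)}, 𝐑^{(j)}, 𝐁^{(j)}` for `j > k`), `E′ = E_k(init s′)`; (i) by §0 from `SLaw_k`'s laws at `init s′` through
`sect2TowerOfRecord_rzAt_succ_eq_init_of_Omega_empty`, the run's RG equation (`settingOfRecord₁₃_satisfiesRG`) and `0 ≤ g_{k+1}` (`gOfRecord₁₃_succ_nonneg`); (ii) is dag-n11-d's
clause for `t (init s′)` read through §1 (the slot at `s′` does not see the truncation). [cite: Balaban1988Convergent, Thm 1 p.262, §2 p.262, Theorem p.245, (3.24)–(3.25) p.270, (2.23)–(2.31) pp.258–260, (2.40)–(2.42) p.261; Balaban1989LargeFieldI, (0.2)–(0.3) p.176; Balaban1987RG1, (0.20) p.256] -/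
theorem exists_lawsT_clause_succ_CoPH_of_Omega_empty_of_sLaw₁₃CoPH (h : θ.Provisos₁₃CoPH F N) {k : ℕ} (hk : k < p.K) (hM : 1 ≤ θ.τ9.M)
    (hE₀ : 0 ≤ θ.s2.lf.E₀) (hB₀ : 0 ≤ θ.s2.lf.B₀) (hS : SLaw₁₃CoPH F N θ p k)
    (s : SeqOfRecord F θ.ν θ.τ9.M (gOfRecord₁₃ F N θ.toStage13Params p) p.K (k + 1)) (hΩ : s.Ω (k + 1) = ∅)
    (hqloc : ∀ j, j < k → ∀ ω ω' : MultiCfg (F.P p.K) (SU N) (FluctV N), (∀ i, i ≤ k → ω i = ω' i) →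
      (θ.zhAt p s).quad j (s.init.Λ (j + 1)) ω = (θ.zhAt p s).quad j (s.init.Λ (j + 1)) ω')
    (hpre : ∀ j, j < k → (θ.zhAt p s).ζ0 j = (θ.zhAt p s.init).ζ0 j ∧ (θ.zhAt p s).quad j = (θ.zhAt p s.init).quad j)
    (hA : ∀ (t₀ : Sect2.TermValues (F.P p.K) (MatA N) (FluctV N) θ.τ9.M) (E₀ : ℝ) (S : ℕ → Set (Site (F.P p.K) 0))
      (a a' : Tk.MSFluct (F.P p.K) (FluctV N)) (Uf : GaugeField (F.P p.K) 0 (SU N)), (∀ i, i ≤ k → a i = a' i) →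
      (sect2ActionDataOfRecord F N (FluctV N) p.K (settingOfRecord₁₃ F N θ.toStage13Params p) (θ.rzAt p s.init) s.init t₀ (S, a) E₀).action23 k Uf =
        (sect2ActionDataOfRecord F N (FluctV N) p.K (settingOfRecord₁₃ F N θ.toStage13Params p) (θ.rzAt p s.init) s.init t₀ (S, a') E₀).action23 k Uf)
    (hZ : ∀ (V' : GaugeField (F.P p.K) (k + 1) (SU N)) (U₀ : GaugeField (F.P p.K) k (SU N)),
      (θ.zhAt p s).ζ0 k Set.univ (pairCfgAt (V := FluctV N) k V' U₀) =
        chiSeqOfRecord F N θ.ν θ.τ9.M (gOfRecord₁₃ F N θ.toStage13Params p) p.K k s.init U₀ *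
          wOfRecord₉ F N θ.toStage9Params p (gOfRecord₁₃ F N θ.toStage13Params p) k s U₀ ((avOfRecord F N p.K k).avg U₀))
    (hq : ∀ (V' : GaugeField (F.P p.K) (k + 1) (SU N)) (U₀ : GaugeField (F.P p.K) k (SU N)), (θ.zhAt p s).quad k ∅ (pairCfgAt (V := FluctV N) k V' U₀) = 0)
    {C : ℝ}
    (hm : ∀ (t₀ : Sect2.TermValues (F.P p.K) (MatA N) (FluctV N) θ.τ9.M) (E₀ : ℝ),
      ∀ S ∈ admSOfRecord F θ.ν θ.τ9.M (gOfRecord₁₃ F N θ.toStage13Params p) p.K k s.init,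
      Measurable (Function.uncurry (noExpIntegrandAt F N (FluctV N) p.K k (WtOfRecord₁₃H F N θ p s)
        (tkBranchOfRecord F N (FluctV N) θ.ν θ.τ9.M _ p.K (WtOfRecord₁₃H F N θ p s) s.init S k
          (fun ω => sect2Operand F N (FluctV N) p.K (settingOfRecord₁₃ F N θ.toStage13Params p) (θ.rzAt p s) s t₀ E₀
            (UbgOfRecord₁₃CoP F N θ.toStage13Params p (k + 1) s) (S, fun j => (ω j).2) (fun j => (ω j).1))))))
    (hC : ∀ (t₀ : Sect2.TermValues (F.P p.K) (MatA N) (FluctV N) θ.τ9.M) (E₀ : ℝ),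
      ∀ S ∈ admSOfRecord F θ.ν θ.τ9.M (gOfRecord₁₃ F N θ.toStage13Params p) p.K k s.init, ∀ V' U₀,
      |noExpIntegrandAt F N (FluctV N) p.K k (WtOfRecord₁₃H F N θ p s)
        (tkBranchOfRecord F N (FluctV N) θ.ν θ.τ9.M _ p.K (WtOfRecord₁₃H F N θ p s) s.init S k
          (fun ω => sect2Operand F N (FluctV N) p.K (settingOfRecord₁₃ F N θ.toStage13Params p) (θ.rzAt p s) s t₀ E₀
            (UbgOfRecord₁₃CoP F N θ.toStage13Params p (k + 1) s) (S, fun j => (ω j).2) (fun j => (ω j).1)))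
        V' U₀| ≤ C) :
    ∃ (t₀ : Sect2.TermValues (F.P p.K) (MatA N) (FluctV N) θ.τ9.M) (E' : ℝ),
      Sect2.LawsT (sect2TowerOfRecord F N (FluctV N) p.K (settingOfRecord₁₃ F N θ.toStage13Params p) (θ.rzAt p s) s t₀)
          (settingOfRecord₁₃ F N θ.toStage13Params p).lf (settingOfRecord₁₃ F N θ.toStage13Params p).βc k ∧
        (slotsTOfRecord F N θ.ν θ.τ9 (EOfRecord₁₃ F N θ.toStage13Params) (wOfRecord₉ F N θ.toStage9Params) θ.ppSel p
            (gOfRecord₁₃ F N θ.toStage13Params p) (k + 1) s = 0 ∨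
          ∀ᵐ V' ∂fieldMeasure (F.P p.K) (k + 1) (SU N),
            chiSeqOfRecord F N θ.ν θ.τ9.M (gOfRecord₁₃ F N θ.toStage13Params p) p.K (k + 1) s V' ≠ 0 →
              slotsTOfRecord F N θ.ν θ.τ9 (EOfRecord₁₃ F N θ.toStage13Params) (wOfRecord₉ F N θ.toStage9Params) θ.ppSel p
                  (gOfRecord₁₃ F N θ.toStage13Params p) (k + 1) s V' =
                sect2Slot F N (FluctV N) p.K (settingOfRecord₁₃ F N θ.toStage13Params p) (θ.rzAt p s) (WtOfRecord₁₃H F N θ p s) s t₀ E'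
                  (UbgOfRecord₁₃CoP F N θ.toStage13Params p (k + 1) s) V') := by
  obtain ⟨t, Ek, -, hs⟩ := (sLaw₁₃CoPH_iff F N θ p k).1 hS
  obtain ⟨t₀, hlaw, hcl⟩ := exists_lawsT_clause_succ_CoPH_of_Omega_empty_of_lawsRT_of_clause θ p h hk hM hE₀ hB₀ s hΩ hqloc hpre (t s.init) (Ek s.init)
    (hA _ _) (hs s.init).1 (hs s.init).2 hZ hq (hm _ _) (hC _ _)
  exact ⟨t₀, Ek s.init, hlaw, hcl⟩

/-- **★ … READ THROUGH 𝐑 ON THE LIVE-SELECTOR LINE, CLAUSE-KEYED**: the same witness-carrying step under node00-def-T's selector clause, admissibility and `0 ≤ κ` in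
addition gives `t₀` with `Sect2.LawsRT (sect2TowerOfRecord … (θ.rzAt p s′) s′ t₀) lf (k+1)` (11c's `LawsT.toRT_succ`; `0 ≤ β` from admissibility, `0 ≤ g_{k+1}` free) AND the
post-𝐑 §2 dichotomy of `ρ_{k+1}`'s slot at `s′` at `(t₀, E₀)` (this seat's `slotClauseΦ_succ_of_slotTClauseΦ_of_liveSel_of_rstep` from row `rstep`) — the complete `s′`-conjunct
of the §2 form of `ρ_{k+1}` from the `init s′`-conjunct of the §2 form of `ρ_k`, along a no-expansion step after any history. [cite: Balaban1988Convergent, Thm 1 p.262, §2 p.262, Theorem p.245, (3.24)–(3.25) p.270, (2.17)–(2.18) p.257, p.279; Balaban1989LargeFieldI, (0.2)–(0.4) p.176, p.177 (i)–(ii)] -/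
theorem exists_lawsRT_slotClause_succ_CoPH_of_Omega_empty_of_lawsRT_of_clause_of_liveSel (h : θ.Provisos₁₃CoPH F N)
    (hsel : θ.ppSel = ppSelLiveOfRecord F N θ.ν θ.τ9 (EOfRecord₁₃ F N θ.toStage13Params) (wOfRecord₉ F N θ.toStage9Params))
    (hθ : θ.Admissible F N) (hκ : 0 ≤ θ.s2.lf.κ) (hE₀ : 0 ≤ θ.s2.lf.E₀) (hB₀ : 0 ≤ θ.s2.lf.B₀)
    {k : ℕ} (hk : k < p.K) (hM : 1 ≤ θ.τ9.M)
    (s : SeqOfRecord F θ.ν θ.τ9.M (gOfRecord₁₃ F N θ.toStage13Params p) p.K (k + 1)) (hΩ : s.Ω (k + 1) = ∅)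
    (hqloc : ∀ j, j < k → ∀ ω ω' : MultiCfg (F.P p.K) (SU N) (FluctV N), (∀ i, i ≤ k → ω i = ω' i) →
      (θ.zhAt p s).quad j (s.init.Λ (j + 1)) ω = (θ.zhAt p s).quad j (s.init.Λ (j + 1)) ω')
    (hpre : ∀ j, j < k → (θ.zhAt p s).ζ0 j = (θ.zhAt p s.init).ζ0 j ∧ (θ.zhAt p s).quad j = (θ.zhAt p s.init).quad j)
    (t : Sect2.TermValues (F.P p.K) (MatA N) (FluctV N) θ.τ9.M) (E₀ : ℝ)
    (hA : ∀ (S : ℕ → Set (Site (F.P p.K) 0)) (a a' : Tk.MSFluct (F.P p.K) (FluctV N)) (Uf : GaugeField (F.P p.K) 0 (SU N)), (∀ i, i ≤ k → a i = a' i) →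
      (sect2ActionDataOfRecord F N (FluctV N) p.K (settingOfRecord₁₃ F N θ.toStage13Params p) (θ.rzAt p s.init) s.init t (S, a) E₀).action23 k Uf =
        (sect2ActionDataOfRecord F N (FluctV N) p.K (settingOfRecord₁₃ F N θ.toStage13Params p) (θ.rzAt p s.init) s.init t (S, a') E₀).action23 k Uf)
    (hlaw : Sect2.LawsRT (sect2TowerOfRecord F N (FluctV N) p.K (settingOfRecord₁₃ F N θ.toStage13Params p) (θ.rzAt p s.init) s.init t)
      (settingOfRecord₁₃ F N θ.toStage13Params p).lf k)
    (hid : slotsOfRecord F N θ.ν θ.τ9 (EOfRecord₁₃ F N θ.toStage13Params) (wOfRecord₉ F N θ.toStage9Params) θ.ppSel p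
        (gOfRecord₁₃ F N θ.toStage13Params p) k s.init = 0 ∨
      ∀ᵐ U₀ ∂fieldMeasure (F.P p.K) k (SU N),
        chiSeqOfRecord F N θ.ν θ.τ9.M (gOfRecord₁₃ F N θ.toStage13Params p) p.K k s.init U₀ ≠ 0 →
          slotsOfRecord F N θ.ν θ.τ9 (EOfRecord₁₃ F N θ.toStage13Params) (wOfRecord₉ F N θ.toStage9Params) θ.ppSel p
              (gOfRecord₁₃ F N θ.toStage13Params p) k s.init U₀ =
            sect2Slot F N (FluctV N) p.K (settingOfRecord₁₃ F N θ.toStage13Params p) (θ.rzAt p s.init) (WtOfRecord₁₃H F N θ p s.init) s.init t E₀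
              (UbgOfRecord₁₃CoP F N θ.toStage13Params p k s.init) U₀)
    (hZ : ∀ (V' : GaugeField (F.P p.K) (k + 1) (SU N)) (U₀ : GaugeField (F.P p.K) k (SU N)),
      (θ.zhAt p s).ζ0 k Set.univ (pairCfgAt (V := FluctV N) k V' U₀) =
        chiSeqOfRecord F N θ.ν θ.τ9.M (gOfRecord₁₃ F N θ.toStage13Params p) p.K k s.init U₀ *
          wOfRecord₉ F N θ.toStage9Params p (gOfRecord₁₃ F N θ.toStage13Params p) k s U₀ ((avOfRecord F N p.K k).avg U₀))
    (hq : ∀ (V' : GaugeField (F.P p.K) (k + 1) (SU N)) (U₀ : GaugeField (F.P p.K) k (SU N)), (θ.zhAt p s).quad k ∅ (pairCfgAt (V := FluctV N) k V' U₀) = 0)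
    {C : ℝ}
    (hm : ∀ S ∈ admSOfRecord F θ.ν θ.τ9.M (gOfRecord₁₃ F N θ.toStage13Params p) p.K k s.init,
      Measurable (Function.uncurry (noExpIntegrandAt F N (FluctV N) p.K k (WtOfRecord₁₃H F N θ p s)
        (tkBranchOfRecord F N (FluctV N) θ.ν θ.τ9.M _ p.K (WtOfRecord₁₃H F N θ p s) s.init S k
          (fun ω => sect2Operand F N (FluctV N) p.K (settingOfRecord₁₃ F N θ.toStage13Params p) (θ.rzAt p s) s t E₀
            (UbgOfRecord₁₃CoP F N θ.toStage13Params p (k + 1) s) (S, fun j => (ω j).2) (fun j => (ω j).1))))))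
    (hC : ∀ S ∈ admSOfRecord F θ.ν θ.τ9.M (gOfRecord₁₃ F N θ.toStage13Params p) p.K k s.init, ∀ V' U₀,
      |noExpIntegrandAt F N (FluctV N) p.K k (WtOfRecord₁₃H F N θ p s)
        (tkBranchOfRecord F N (FluctV N) θ.ν θ.τ9.M _ p.K (WtOfRecord₁₃H F N θ p s) s.init S k
          (fun ω => sect2Operand F N (FluctV N) p.K (settingOfRecord₁₃ F N θ.toStage13Params p) (θ.rzAt p s) s t E₀
            (UbgOfRecord₁₃CoP F N θ.toStage13Params p (k + 1) s) (S, fun j => (ω j).2) (fun j => (ω j).1)))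
        V' U₀| ≤ C) :
    ∃ t₀ : Sect2.TermValues (F.P p.K) (MatA N) (FluctV N) θ.τ9.M,
      Sect2.LawsRT (sect2TowerOfRecord F N (FluctV N) p.K (settingOfRecord₁₃ F N θ.toStage13Params p) (θ.rzAt p s) s t₀)
          (settingOfRecord₁₃ F N θ.toStage13Params p).lf (k + 1) ∧
        (slotsOfRecord F N θ.ν θ.τ9 (EOfRecord₁₃ F N θ.toStage13Params) (wOfRecord₉ F N θ.toStage9Params) θ.ppSel p
            (gOfRecord₁₃ F N θ.toStage13Params p) (k + 1) s = 0 ∨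
          ∀ᵐ V' ∂fieldMeasure (F.P p.K) (k + 1) (SU N),
            chiSeqOfRecord F N θ.ν θ.τ9.M (gOfRecord₁₃ F N θ.toStage13Params p) p.K (k + 1) s V' ≠ 0 →
              slotsOfRecord F N θ.ν θ.τ9 (EOfRecord₁₃ F N θ.toStage13Params) (wOfRecord₉ F N θ.toStage9Params) θ.ppSel p
                  (gOfRecord₁₃ F N θ.toStage13Params p) (k + 1) s V' =
                sect2Slot F N (FluctV N) p.K (settingOfRecord₁₃ F N θ.toStage13Params p) (θ.rzAt p s) (WtOfRecord₁₃H F N θ p s) s t₀ E₀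
                  (UbgOfRecord₁₃CoP F N θ.toStage13Params p (k + 1) s) V') := by
  obtain ⟨t₀, hlawT, hcl⟩ := exists_lawsT_clause_succ_CoPH_of_Omega_empty_of_lawsRT_of_clause θ p h hk hM hE₀ hB₀ s hΩ hqloc hpre t E₀ hA hlaw hid hZ hq hm hC
  exact ⟨t₀, hlawT.toRT_succ hθ.toStage12.pos.2.1 hκ hE₀ hB₀ (B16RLeafRecord13Live.gOfRecord₁₃_succ_nonneg F N θ.toStage13Params p k),
    slotClauseΦ_succ_of_slotTClauseΦ_of_liveSel_of_rstep F N θ.toStage13Params p (fun q j _ hj => h.rstep q j hj) hsel k hk s _ fun _ => hcl⟩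

/-- **★★ … READ THROUGH 𝐑 ON THE LIVE-SELECTOR LINE: THE COMPLETE `s′`-CONJUNCT OF THE §2 FORM OF `ρ_{k+1}`** — under node00-def-T's selector clause, admissibility and `0 ≤ κ`
in addition: THERE ARE `t₀`, `E′` with `Sect2.LawsRT (sect2TowerOfRecord … (θ.rzAt p s′) s′ t₀) lf (k+1)` (11c's `LawsT.toRT_succ` under the signs; `0 ≤ β` from admissibility,
`0 ≤ g_{k+1}` free) AND the post-𝐑 §2 dichotomy of `ρ_{k+1}`'s slot at `s′` at `(t₀, E′)` (this seat's `slotClauseΦ_succ_of_slotTClauseΦ_of_liveSel_of_rstep` from row `rstep`)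
— Theorem 1's inductive step on the no-expansion branch after any history, laws included, at ONE sequence. [cite: Balaban1988Convergent, Thm 1 p.262, §2 p.262, Theorem p.245, (3.24)–(3.25) p.270, (2.17)–(2.18) p.257, p.279; Balaban1989LargeFieldI, (0.2)–(0.4) p.176, p.177 (i)–(ii)] -/
theorem exists_lawsRT_slotClause_succ_CoPH_of_Omega_empty_of_sLaw₁₃CoPH_of_liveSel (h : θ.Provisos₁₃CoPH F N)
    (hsel : θ.ppSel = ppSelLiveOfRecord F N θ.ν θ.τ9 (EOfRecord₁₃ F N θ.toStage13Params) (wOfRecord₉ F N θ.toStage9Params))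
    (hθ : θ.Admissible F N) (hκ : 0 ≤ θ.s2.lf.κ) (hE₀ : 0 ≤ θ.s2.lf.E₀) (hB₀ : 0 ≤ θ.s2.lf.B₀)
    {k : ℕ} (hk : k < p.K) (hM : 1 ≤ θ.τ9.M) (hS : SLaw₁₃CoPH F N θ p k)
    (s : SeqOfRecord F θ.ν θ.τ9.M (gOfRecord₁₃ F N θ.toStage13Params p) p.K (k + 1)) (hΩ : s.Ω (k + 1) = ∅)
    (hqloc : ∀ j, j < k → ∀ ω ω' : MultiCfg (F.P p.K) (SU N) (FluctV N), (∀ i, i ≤ k → ω i = ω' i) →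
      (θ.zhAt p s).quad j (s.init.Λ (j + 1)) ω = (θ.zhAt p s).quad j (s.init.Λ (j + 1)) ω')
    (hpre : ∀ j, j < k → (θ.zhAt p s).ζ0 j = (θ.zhAt p s.init).ζ0 j ∧ (θ.zhAt p s).quad j = (θ.zhAt p s.init).quad j)
    (hA : ∀ (t₀ : Sect2.TermValues (F.P p.K) (MatA N) (FluctV N) θ.τ9.M) (E₀ : ℝ) (S : ℕ → Set (Site (F.P p.K) 0))
      (a a' : Tk.MSFluct (F.P p.K) (FluctV N)) (Uf : GaugeField (F.P p.K) 0 (SU N)), (∀ i, i ≤ k → a i = a' i) →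
      (sect2ActionDataOfRecord F N (FluctV N) p.K (settingOfRecord₁₃ F N θ.toStage13Params p) (θ.rzAt p s.init) s.init t₀ (S, a) E₀).action23 k Uf =
        (sect2ActionDataOfRecord F N (FluctV N) p.K (settingOfRecord₁₃ F N θ.toStage13Params p) (θ.rzAt p s.init) s.init t₀ (S, a') E₀).action23 k Uf)
    (hZ : ∀ (V' : GaugeField (F.P p.K) (k + 1) (SU N)) (U₀ : GaugeField (F.P p.K) k (SU N)),
      (θ.zhAt p s).ζ0 k Set.univ (pairCfgAt (V := FluctV N) k V' U₀) =
        chiSeqOfRecord F N θ.ν θ.τ9.M (gOfRecord₁₃ F N θ.toStage13Params p) p.K k s.init U₀ *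
          wOfRecord₉ F N θ.toStage9Params p (gOfRecord₁₃ F N θ.toStage13Params p) k s U₀ ((avOfRecord F N p.K k).avg U₀))
    (hq : ∀ (V' : GaugeField (F.P p.K) (k + 1) (SU N)) (U₀ : GaugeField (F.P p.K) k (SU N)), (θ.zhAt p s).quad k ∅ (pairCfgAt (V := FluctV N) k V' U₀) = 0)
    {C : ℝ}
    (hm : ∀ (t₀ : Sect2.TermValues (F.P p.K) (MatA N) (FluctV N) θ.τ9.M) (E₀ : ℝ),
      ∀ S ∈ admSOfRecord F θ.ν θ.τ9.M (gOfRecord₁₃ F N θ.toStage13Params p) p.K k s.init,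
      Measurable (Function.uncurry (noExpIntegrandAt F N (FluctV N) p.K k (WtOfRecord₁₃H F N θ p s)
        (tkBranchOfRecord F N (FluctV N) θ.ν θ.τ9.M _ p.K (WtOfRecord₁₃H F N θ p s) s.init S k
          (fun ω => sect2Operand F N (FluctV N) p.K (settingOfRecord₁₃ F N θ.toStage13Params p) (θ.rzAt p s) s t₀ E₀
            (UbgOfRecord₁₃CoP F N θ.toStage13Params p (k + 1) s) (S, fun j => (ω j).2) (fun j => (ω j).1))))))
    (hC : ∀ (t₀ : Sect2.TermValues (F.P p.K) (MatA N) (FluctV N) θ.τ9.M) (E₀ : ℝ),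
      ∀ S ∈ admSOfRecord F θ.ν θ.τ9.M (gOfRecord₁₃ F N θ.toStage13Params p) p.K k s.init, ∀ V' U₀,
      |noExpIntegrandAt F N (FluctV N) p.K k (WtOfRecord₁₃H F N θ p s)
        (tkBranchOfRecord F N (FluctV N) θ.ν θ.τ9.M _ p.K (WtOfRecord₁₃H F N θ p s) s.init S k
          (fun ω => sect2Operand F N (FluctV N) p.K (settingOfRecord₁₃ F N θ.toStage13Params p) (θ.rzAt p s) s t₀ E₀
            (UbgOfRecord₁₃CoP F N θ.toStage13Params p (k + 1) s) (S, fun j => (ω j).2) (fun j => (ω j).1)))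
        V' U₀| ≤ C) :
    ∃ (t₀ : Sect2.TermValues (F.P p.K) (MatA N) (FluctV N) θ.τ9.M) (E' : ℝ),
      Sect2.LawsRT (sect2TowerOfRecord F N (FluctV N) p.K (settingOfRecord₁₃ F N θ.toStage13Params p) (θ.rzAt p s) s t₀)
          (settingOfRecord₁₃ F N θ.toStage13Params p).lf (k + 1) ∧
        (slotsOfRecord F N θ.ν θ.τ9 (EOfRecord₁₃ F N θ.toStage13Params) (wOfRecord₉ F N θ.toStage9Params) θ.ppSel p
            (gOfRecord₁₃ F N θ.toStage13Params p) (k + 1) s = 0 ∨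
          ∀ᵐ V' ∂fieldMeasure (F.P p.K) (k + 1) (SU N),
            chiSeqOfRecord F N θ.ν θ.τ9.M (gOfRecord₁₃ F N θ.toStage13Params p) p.K (k + 1) s V' ≠ 0 →
              slotsOfRecord F N θ.ν θ.τ9 (EOfRecord₁₃ F N θ.toStage13Params) (wOfRecord₉ F N θ.toStage9Params) θ.ppSel p
                  (gOfRecord₁₃ F N θ.toStage13Params p) (k + 1) s V' =
                sect2Slot F N (FluctV N) p.K (settingOfRecord₁₃ F N θ.toStage13Params p) (θ.rzAt p s) (WtOfRecord₁₃H F N θ p s) s t₀ E'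
                  (UbgOfRecord₁₃CoP F N θ.toStage13Params p (k + 1) s) V') := by
  obtain ⟨t₀, E', hlaw, hcl⟩ := exists_lawsT_clause_succ_CoPH_of_Omega_empty_of_sLaw₁₃CoPH θ p h hk hM hE₀ hB₀ hS s hΩ hqloc hpre hA hZ hq hm hC
  exact ⟨t₀, E', hlaw.toRT_succ hθ.toStage12.pos.2.1 hκ hE₀ hB₀ (B16RLeafRecord13Live.gOfRecord₁₃_succ_nonneg F N θ.toStage13Params p k),
    slotClauseΦ_succ_of_slotTClauseΦ_of_liveSel_of_rstep F N θ.toStage13Params p (fun q j _ hj => h.rstep q j hj) hsel k hk s _ fun _ => hcl⟩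

end LawsCoPH

end Summit.QuantumFields.YangMills.Theorems.BalabanUVNodesN11NoExpansionGeneralStepLawsCoPH

end
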